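import Summits.ResolutionOfSingularities.ResolutionOfSingularities.Theorems.WeightedInvariantHypersurfaceLocalGameEFT4S

/-!
# `HypersurfaceCentreConstruction` — negative lemma: a FORCED DESCENT CHAIN kills the canonical e.f.t. game

Door crux `stmt-ResolutionOfSingularities-19897`
(`Summit.ResolutionOfSingularities.ResolutionOfSingularities.Theorems.HypersurfaceCentreConstruction`, route
`ResolutionOfSingularities/WeightedInvariant`, line `local-engine` v3.1, key stub `stub_localWeightedDropEFT4S` over the tree modules
`…HypersurfaceLocalGameEFT3` (p501595) / `…EFT4S` (p504475)); support item `stmt-ResolutionOfSingularities-0571` (`WeightedConstruction`).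
Refuter res-L1-w43-tri-1 (TRIAGER 1, lens «kangaroo discharge»), 2026-08-27; no definitions, proofs only.

[OURS · L1 W4.3 · AI-produced negative knowledge, weaker than expert review; nothing here asserts anything about Hironaka's problem.]

The only shape a refutation of the keys `LocalWeightedDropEFT3 p` / `LocalWeightedDropEFT4S p` can take is «no pair `(ι, J)` exists».
res-L1-w43-idea-2's card `reproduction-census` (HOME Sketch-R4, `no_canonicalGame_of_reproducing`) typed the CONSTANT case: ONE position
all of whose presented admissible moves have a successor reproducing the position up to (c6) + (c11).  The specimen families met by the
triage (tri-1 TRIAGE v5 §15: `z⁴ + x²y⁴ + tᵏy⁵ ↦ k' = kj + m` under the centres through the forced line with weights `(m, m, j)`;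
`z⁴ + x²y⁴ + tᵏy⁵ + tᴺy ↦ (kj + m, Nj − 3m)`) are NOT reproductions — the position changes at every move — so the adversary's
honest obligation is a CHAIN, not a fixed point.  This file proves the chain form, with the adversary's obligation written INLINE as the
hypothesis `hchain` (no `def`):

* `hchain` — along a sequence of e.f.t. positions `(S i, f i)` over one perfect field `k₀` of characteristic `p`, at EVERY position `i`
  EVERY presented admissible move (a prime `P ∋ f i`, a system `u` spanning the maximal ideal, weights `w` not all zero whose positively
  weighted members span `P` — the data (pres) of `CanonicalGameClause`) has a successor prime `𝔫` of `B = cobordantAlgebra' u w`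
  (`t⁻¹ ∈ 𝔫 ⊇ P·B`, `𝔫` off the vertex, `t⁻¹`-saturated factor `g` of `f i` singular at `𝔫`) and a ring isomorphism of `B_𝔫` with an
  essentially smooth local extension `S'` of the NEXT ring `S (i+1)` carrying `g` to `f (i+1) ⊗ 1`;
* `canonicalGameClause_false_of_forcedDescentChain` — such a chain refutes `CanonicalGameClause p ι J` for every `(ι, J)` with (c6)
  `IotaIsoInvariant ι` and (c11) `IotaJEssSmoothCompatible ι J`: (c9′) hands a move at `(S i, f i)` whose singular successors all have
  smaller `ι`; the chain hands a successor of THAT move carrying the value `ι (S (i+1)) (f (i+1))`; so `i ↦ ι (S i) (f i)` is a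
  strictly decreasing `ℕ`-sequence of ordinals (`RelEmbedding.natGT … |>.not_wellFounded wellFounded_lt`);
* `localWeightedDropEFT3_false_of_forcedDescentChain`, `localWeightedDropEFT4S_false_of_forcedDescentChain` — the two keyed
  candidates, by projection to (c6), (c11), (c9′).  The constant sequence `S i := S, f i := f` is idea-2's reproduction lemma.

No chain is claimed to exist: every specimen of the w43 bank escapes (TRIAGE v5 §15.4–§15.5: the plane centre at `z⁴ + x²y⁴ + tᵏy⁵`,
the weights `(N, N, 3)` at `z⁴ + x²y⁴ + tᵏy⁵ + tᴺy`).  The lemma fixes the TARGET of a descent census: a kill of the key needs a family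
of positions in which EVERY move is answered inside the family with the index moving, not a self-reproducing position.
-/

noncomputable section

open IsLocalRing AlgebraicGeometry CategoryTheory Literature.AlgebraicGeometry.Resolution
open Summit.ResolutionOfSingularities.ResolutionOfSingularities.Cruxes.HypersurfaceCentreConstruction.LocalEngine

set_option linter.dupNamespace false

namespace Summit.ResolutionOfSingularities.ResolutionOfSingularities.Theorems.HypersurfaceCentreConstruction.Negative

/-- **A forced descent chain kills the canonical game clause** for every `(ι, J)` with (c6) and (c11): along the chain
`i ↦ ι (S i) (f i)` would be a strictly decreasing `ℕ`-indexed sequence of ordinals.  At position `i` the clause (c9′) supplies a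
presented admissible move with the drop at all its singular successors off the vertex over the centre; `hchain` supplies such a
successor whose position is `(S', f (i+1) ⊗ 1)` up to a ring isomorphism, `S (i+1) → S'` essentially smooth local; (c6) + (c11)
transport `ι` along it.  (Generalises res-L1-w43-idea-2's Sketch-R4 `no_canonicalGame_of_reproducing` = the constant chain.) [folklore] -/
theorem canonicalGameClause_false_of_forcedDescentChain (p : ℕ) (ι : (R : Type) → [CommRing R] → R → Ordinal.{0})
    (J : (R : Type) → [CommRing R] → R → ℕ → Ideal R)
    (h6 : IotaIsoInvariant ι) (h11 : IotaJEssSmoothCompatible ι J)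
    (k₀ : Type) [Field k₀] [CharP k₀ p] [PerfectField k₀]
    (S : ℕ → Type) [∀ i, CommRing (S i)] [∀ i, Algebra k₀ (S i)] [∀ i, Algebra.EssFiniteType k₀ (S i)]
    [∀ i, IsRegularLocalRing (S i)] (f : ∀ i, S i) (hf0 : ∀ i, f i ≠ 0) (hf2 : ∀ i, f i ∈ (maximalIdeal (S i)) ^ 2)
    (hchain : ∀ (i : ℕ) (P : Ideal (S i)) (n : ℕ) (u : Fin n → S i) (w : Fin n → ℕ),
      P.IsPrime → f i ∈ P → Ideal.span (Set.range u) = maximalIdeal (S i) → (∃ j, 0 < w j) →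
      Ideal.span {x | ∃ j, 0 < w j ∧ x = u j} = P →
      ∃ (𝔫 : Ideal (cobordantAlgebra' u w)) (_ : 𝔫.IsPrime),
        cobordantT' u w ∈ 𝔫 ∧ P.map (algebraMap (S i) (cobordantAlgebra' u w)) ≤ 𝔫 ∧
        ¬ (extReesAlgebra.vertexIdeal (weightedMonomialIdeal u w) ≤ 𝔫) ∧
        ∃ (a : ℕ) (g : cobordantAlgebra' u w),
          algebraMap (S i) (cobordantAlgebra' u w) (f i) = cobordantT' u w ^ a * g ∧ ¬ (cobordantT' u w ∣ g) ∧
          algebraMap (cobordantAlgebra' u w) (Localization.AtPrime 𝔫) g ∈ (maximalIdeal (Localization.AtPrime 𝔫)) ^ 2 ∧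
          ∃ (S' : Type) (_ : CommRing S') (_ : IsRegularLocalRing S') (_ : Algebra (S (i + 1)) S')
            (_ : IsLocalHom (algebraMap (S (i + 1)) S')) (_ : Algebra.FormallySmooth (S (i + 1)) S')
            (_ : Algebra.EssFiniteType (S (i + 1)) S') (e : Localization.AtPrime 𝔫 ≃+* S'),
            e (algebraMap (cobordantAlgebra' u w) (Localization.AtPrime 𝔫) g) = algebraMap (S (i + 1)) S' (f (i + 1))) :
    ¬ CanonicalGameClause p ι J := by
  intro hgame
  have hlt : ∀ i : ℕ, ι (S (i + 1)) (f (i + 1)) < ι (S i) (f i) := by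
    intro i
    obtain ⟨P, hP, -, hfP, -, -, n, u, w, hspan, -, hpos, hcentre, -, -, hdrop⟩ :=
      hgame k₀ (S i) (f i) (hf0 i) (hf2 i)
    obtain ⟨𝔫, h𝔫, ht, hP𝔫, hv, a, g, hfg, hndvd, hg2, S', _, _, _, _, _, _, e, he⟩ :=
      hchain i P n u w hP hfP hspan hpos hcentre
    have h := hdrop 𝔫 ht hP𝔫 hv a g hfg hndvd hg2
    have h1 : ι S' (e (algebraMap (cobordantAlgebra' u w) (Localization.AtPrime 𝔫) g)) =
        ι (Localization.AtPrime 𝔫) (algebraMap (cobordantAlgebra' u w) (Localization.AtPrime 𝔫) g) :=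
      h6 (Localization.AtPrime 𝔫) S' e (algebraMap (cobordantAlgebra' u w) (Localization.AtPrime 𝔫) g)
    have h2 : ι S' (algebraMap (S (i + 1)) S' (f (i + 1))) = ι (S (i + 1)) (f (i + 1)) :=
      (h11 (S (i + 1)) S' (f (i + 1))).1
    rw [← h1, he, h2] at h
    exact h
  exact (RelEmbedding.natGT (fun i => ι (S i) (f i)) hlt).not_wellFounded wellFounded_lt

/-- Corollary: a forced descent chain in characteristic `p` refutes H2a‴ `LocalWeightedDropEFT3 p` (projection to (c6), (c11),
(c9′)). [folklore] -/
theorem localWeightedDropEFT3_false_of_forcedDescentChain (p : ℕ)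
    (k₀ : Type) [Field k₀] [CharP k₀ p] [PerfectField k₀]
    (S : ℕ → Type) [∀ i, CommRing (S i)] [∀ i, Algebra k₀ (S i)] [∀ i, Algebra.EssFiniteType k₀ (S i)]
    [∀ i, IsRegularLocalRing (S i)] (f : ∀ i, S i) (hf0 : ∀ i, f i ≠ 0) (hf2 : ∀ i, f i ∈ (maximalIdeal (S i)) ^ 2)
    (hchain : ∀ (i : ℕ) (P : Ideal (S i)) (n : ℕ) (u : Fin n → S i) (w : Fin n → ℕ),
      P.IsPrime → f i ∈ P → Ideal.span (Set.range u) = maximalIdeal (S i) → (∃ j, 0 < w j) →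
      Ideal.span {x | ∃ j, 0 < w j ∧ x = u j} = P →
      ∃ (𝔫 : Ideal (cobordantAlgebra' u w)) (_ : 𝔫.IsPrime),
        cobordantT' u w ∈ 𝔫 ∧ P.map (algebraMap (S i) (cobordantAlgebra' u w)) ≤ 𝔫 ∧
        ¬ (extReesAlgebra.vertexIdeal (weightedMonomialIdeal u w) ≤ 𝔫) ∧
        ∃ (a : ℕ) (g : cobordantAlgebra' u w),
          algebraMap (S i) (cobordantAlgebra' u w) (f i) = cobordantT' u w ^ a * g ∧ ¬ (cobordantT' u w ∣ g) ∧
          algebraMap (cobordantAlgebra' u w) (Localization.AtPrime 𝔫) g ∈ (maximalIdeal (Localization.AtPrime 𝔫)) ^ 2 ∧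
          ∃ (S' : Type) (_ : CommRing S') (_ : IsRegularLocalRing S') (_ : Algebra (S (i + 1)) S')
            (_ : IsLocalHom (algebraMap (S (i + 1)) S')) (_ : Algebra.FormallySmooth (S (i + 1)) S')
            (_ : Algebra.EssFiniteType (S (i + 1)) S') (e : Localization.AtPrime 𝔫 ≃+* S'),
            e (algebraMap (cobordantAlgebra' u w) (Localization.AtPrime 𝔫) g) = algebraMap (S (i + 1)) S' (f (i + 1))) :
    ¬ LocalWeightedDropEFT3 p := by
  rintro ⟨ι, J, h6, -, -, -, -, h11, hgame, -, -, -⟩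
  exact canonicalGameClause_false_of_forcedDescentChain p ι J h6 h11 k₀ S f hf0 hf2 hchain hgame

/-- Corollary: a forced descent chain in characteristic `p` refutes the v3.1 key H2a⁗ `LocalWeightedDropEFT4S p`. [folklore] -/
theorem localWeightedDropEFT4S_false_of_forcedDescentChain (p : ℕ)
    (k₀ : Type) [Field k₀] [CharP k₀ p] [PerfectField k₀]
    (S : ℕ → Type) [∀ i, CommRing (S i)] [∀ i, Algebra k₀ (S i)] [∀ i, Algebra.EssFiniteType k₀ (S i)]
    [∀ i, IsRegularLocalRing (S i)] (f : ∀ i, S i) (hf0 : ∀ i, f i ≠ 0) (hf2 : ∀ i, f i ∈ (maximalIdeal (S i)) ^ 2)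
    (hchain : ∀ (i : ℕ) (P : Ideal (S i)) (n : ℕ) (u : Fin n → S i) (w : Fin n → ℕ),
      P.IsPrime → f i ∈ P → Ideal.span (Set.range u) = maximalIdeal (S i) → (∃ j, 0 < w j) →
      Ideal.span {x | ∃ j, 0 < w j ∧ x = u j} = P →
      ∃ (𝔫 : Ideal (cobordantAlgebra' u w)) (_ : 𝔫.IsPrime),
        cobordantT' u w ∈ 𝔫 ∧ P.map (algebraMap (S i) (cobordantAlgebra' u w)) ≤ 𝔫 ∧
        ¬ (extReesAlgebra.vertexIdeal (weightedMonomialIdeal u w) ≤ 𝔫) ∧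
        ∃ (a : ℕ) (g : cobordantAlgebra' u w),
          algebraMap (S i) (cobordantAlgebra' u w) (f i) = cobordantT' u w ^ a * g ∧ ¬ (cobordantT' u w ∣ g) ∧
          algebraMap (cobordantAlgebra' u w) (Localization.AtPrime 𝔫) g ∈ (maximalIdeal (Localization.AtPrime 𝔫)) ^ 2 ∧
          ∃ (S' : Type) (_ : CommRing S') (_ : IsRegularLocalRing S') (_ : Algebra (S (i + 1)) S')
            (_ : IsLocalHom (algebraMap (S (i + 1)) S')) (_ : Algebra.FormallySmooth (S (i + 1)) S')
            (_ : Algebra.EssFiniteType (S (i + 1)) S') (e : Localization.AtPrime 𝔫 ≃+* S'),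
            e (algebraMap (cobordantAlgebra' u w) (Localization.AtPrime 𝔫) g) = algebraMap (S (i + 1)) S' (f (i + 1))) :
    ¬ LocalWeightedDropEFT4S p := by
  rintro ⟨ι, J, h6, -, -, -, -, h11, hgame, -, -, -⟩
  exact canonicalGameClause_false_of_forcedDescentChain p ι J h6 h11 k₀ S f hf0 hf2 hchain hgame

end Summit.ResolutionOfSingularities.ResolutionOfSingularities.Theorems.HypersurfaceCentreConstruction.Negative

end
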